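import Summits.QuantumAdvantage.AdviceFreeQNC0.AdviceFreeQNC0Odd
import Summits.QuantumAdvantage.QuantumAdvantage.Theorems.RingFrameBridge
import Summits.QuantumAdvantage.QuantumAdvantage.Theorems.MultiRingGridCycles
import Summits.QuantumAdvantage.QuantumAdvantage.Theorems.MultiRingRowSquares
import Summits.QuantumAdvantage.AdviceFreeQNC0.WalkTubeRank
import Literature.Computability.MetaComplexity.SmolenskyCorrelationRestrict
import Summits.QuantumAdvantage.QuantumAdvantage.Theses.HardCore
import HarnessLib

/-!
# SpreadCoreBridge (v2, gate-clean) — LAND-READY Theorems twin of the lens-6 g6 node «SpreadCore» (cell decomp-qadv)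

Target path: `Summits/QuantumAdvantage/QuantumAdvantage/Theorems/SpreadCoreBridge.lean`
(namespace `Summit.QuantumAdvantage.QuantumAdvantage.Theorems.SpreadCore`; imports the BORN route file `Theses/HardCore.lean`
and names its items BY NAME: `RingPolyLoss8Odd` (26762), `GridCoreDistOdd` (28222), `DistLiftOdd` (28223), `DistBridgeOdd`
(28224), `RingCore8Odd` (27578); no other Theses import; sorry-free; ZERO `def … : Prop` (critic row 38v2 hygiene: the
new predicates T**_μ `SpreadDistOdd`, T♭_μ `MultiRingDistOdd`, T*_μ `RingDistHard8`, the residual `CoverLiftDistOdd`, the flat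
ports and the dial `SpreadWtAt` are INLINED VERBATIM into the theorem statements, so the gate audit reads 0 vendored-fact);
farm `lean check` rc 0 · 0 sorry · 0 warning; `#print axioms` of every theorem ⊆ [propext, Classical.choice, Quot.sound].

What it proves (all kernel-checked; «X» = the inlined text of the node's piece X):
* `gridCoreDistOdd_of_spreadDistOdd : «SpreadDistOdd» → HardCore.GridCoreDistOdd` — WEIGHTED hybrid (`sum_winAll_le_hybrid_wt`)
  ∘ WEIGHTED packing (`gridCoreDistOdd_of_multiRingDistOdd : «MultiRingDistOdd» → HardCore.GridCoreDistOdd`);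
* `distLiftOdd_of_coverLiftDistOdd : (RingPolyLoss8Odd → «SpreadDistOdd») → HardCore.DistLiftOdd` — the residual
  `CoverLiftDistOdd` DOMINATES the declared residual 28223;
* necessity `spreadDistOdd_of_ringCore8Odd : HardCore.RingCore8Odd → «SpreadDistOdd»` (T* ⟹ T*_μ ⟹ T**_μ, with `k := 1` at
  every `c`), `gridCoreDistOdd_of_ringCore8Odd : RingCore8Odd → GridCoreDistOdd` (registered → registered support edge),
  flat ⟹ weighted ports, `gridCoreDistOdd_of_multiRingHard8Odd`, the conditional leaf
  `adviceFreeQNC0Odd_of_coverLiftDistOdd : RingPolyLoss8Odd → «CoverLiftDistOdd» → DistBridgeOdd → AdviceFreeQNC0Odd`,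
  the L-escape law `loss_escapes_lowDeg_test`, and the kill lanes (`refutes.conditional`).
CLOSERS after the writer files the pieces as ITEMS with the node's texts (child route «SpreadCore» --refines HardCore:28223,
or a HardCore edit): a 10-line file importing the new route file + this one, e.g.
`theorem spreadBridgeOdd_holds : Theses.SpreadCore.SpreadBridgeOdd := Theorems.SpreadCore.gridCoreDistOdd_of_spreadDistOdd`
(item texts = inlined texts ⇒ delta-defeq, as the probe's `Iff.rfl` junctions show for 26762/28222/28223/28224/27578).

LANDING (prover/refuter lane; planners cannot propose): `ledger propose --target
Summits/QuantumAdvantage/QuantumAdvantage/Theorems/SpreadCoreBridge.lean --file SpreadCoreBridge.v2.lean --supports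
stmt-QuantumAdvantage-28222 --note "lens-6 g6 SpreadCore: weighted hybrid+packing SpreadDistOdd → GridCoreDistOdd; dominance
of 28223 by CoverLiftDistOdd"`.

Part D (GridCycles / rowSquares packing machinery) is COPIED, with attribution, from seat lens-5's land-ready
`decomp-qadv-lens-5/tree/MultiRingBridge.lean` §1–2 (sha256 d782ca8a…), itself adapted from `Theorems/RingFrameBridge.lean`;
the copies live in the sub-namespace `…Theorems.SpreadCore` and do not clash if that file lands under `…Theorems`
(a follow-up may dedupe by `open`).  Generated from the node by `mk_twin_v2.py` (lens-6 session folder); v1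
(`SpreadCoreBridge.lean`, same theorems with named predicates) is kept for READING.
-/

open Finset
open Literature.Computability.Cryptography Literature.Computability.Complexity
open Literature.Computability.QuantumComplexity Literature.Computability.MetaComplexity

-- the sub-problem namespace `Summit.QuantumAdvantage.QuantumAdvantage` repeats the summit name by design (D-0017)
set_option linter.dupNamespace false

namespace Summit.QuantumAdvantage.QuantumAdvantage.Theorems.SpreadCore

open Summit.QuantumAdvantage.AdviceFreeQNC0 Summit.QuantumAdvantage.QuantumAdvantage.Theorems
open scoped Classical
open Summit.QuantumAdvantage.QuantumAdvantage.Theses.HardCore (RingPolyLoss8Odd GridCoreDistOdd DistLiftOdd DistBridgeOdd RingCore8Odd)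

/-! ## Part A.  Records (VERBATIM tree items of route HardCore) and the new pieces -/

/-! ### The new pieces: the product road run INSIDE the measure closure -/

/-! ### Uniform ports of lens-5's p = 3 dial (asides; the flat specialisations, for the order records) -/

/-! ## Part B.  Kernel edges between the grades (necessity chain; flat ⇒ weighted) -/

/-- bookkeeping: a weighted count over a filter with the indicator weight of `H` is a cardinality. -/
theorem sum_filter_indicator {α : Type*} [Fintype α] [DecidableEq α] (H : Finset α) (W : α → Prop) [DecidablePred W] :
    (∑ y ∈ univ.filter W, (if y ∈ H then 1 else 0 : ℕ)) = (H.filter W).card := by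
  rw [Finset.sum_ite_mem, Finset.sum_const, smul_eq_mul, mul_one]
  congr 1
  ext y
  simp [and_comm]

/-- SpreadCore bridge helper `sum_univ_indicator` (lens-6 g6 SpreadCoreBridge v2; see the enclosing section docstring). -/
theorem sum_univ_indicator {α : Type*} [Fintype α] [DecidableEq α] (H : Finset α) :
    (∑ y, (if y ∈ H then 1 else 0 : ℕ)) = H.card := by
  rw [Finset.sum_ite_mem, Finset.univ_inter, Finset.sum_const, smul_eq_mul, mul_one]

/-- bookkeeping: flat weights count. -/
theorem sum_filter_one {α : Type*} [Fintype α] (W : α → Prop) [DecidablePred W] :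
    (∑ _y ∈ univ.filter W, (1 : ℕ)) = (univ.filter W).card := by
  rw [Finset.sum_const, smul_eq_mul, mul_one]

/-- SpreadCore bridge helper `sum_univ_one_patterns` (lens-6 g6 SpreadCoreBridge v2; see the enclosing section docstring). -/
theorem sum_univ_one_patterns (n : ℕ) : ((∑ _y : Fin n → Bool, (1 : ℕ) : ℕ) : ℝ) = (2 : ℝ) ^ n := by
  rw [Finset.sum_const, smul_eq_mul, mul_one, Finset.card_univ, Fintype.card_fun, Fintype.card_bool,
    Fintype.card_fin]
  push_cast
  rfl

/-- **T* ⟹ T*_μ** at one prime: `RingCore8 p → RingDistHard8 p` (weight `= 𝟙_H`). -/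
theorem ringDistHard8_of_ringCore8 (p : ℕ) [Fact p.Prime] (h : (∃ θ : ℝ, θ < 1 ∧ ∀ c : ℕ, ∃ t₀ : ℕ, ∀ t ≥ t₀, ∃ H : Finset (Fin (8 * t) → Bool), H.Nonempty ∧ ∀ P : Fin (8 * t) → Smolensky.CubeFn (ZMod p) (8 * t), (∀ i, P i ∈ Smolensky.lowDeg (ZMod p) (8 * t) ((Nat.log 2 (8 * t)) ^ c)) → ((H.filter fun x : Fin (8 * t) → Bool => RingHLF.Rel x (fun i => decide (P i x = 1))).card : ℝ) ≤ θ * H.card)) : (∃ θ : ℝ, θ < 1 ∧ ∀ c : ℕ, ∃ t₀ : ℕ, ∀ t ≥ t₀, ∃ wt : (Fin (8 * t) → Bool) → ℕ, 0 < ∑ y, wt y ∧ ∀ P : Fin (8 * t) → Smolensky.CubeFn (ZMod p) (8 * t), (∀ i, P i ∈ Smolensky.lowDeg (ZMod p) (8 * t) ((Nat.log 2 (8 * t)) ^ c)) → ((∑ y ∈ univ.filter (fun y : Fin (8 * t) → Bool => RingHLF.Rel y (fun i => decide (P i y = 1))), wt y : ℕ) : ℝ) ≤ θ * ((∑ y,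 wt y : ℕ) : ℝ)) := by
  obtain ⟨θ, hθ, hc⟩ := h
  refine ⟨θ, hθ, fun c => ?_⟩
  obtain ⟨t₀, ht₀⟩ := hc c
  refine ⟨t₀, fun t ht => ?_⟩
  obtain ⟨H, hH, hwin⟩ := ht₀ t ht
  refine ⟨fun y => if y ∈ H then 1 else 0, ?_, fun P hP => ?_⟩
  · beta_reduce; rw [sum_univ_indicator]; exact Finset.card_pos.mpr hH
  · beta_reduce; rw [sum_filter_indicator, sum_univ_indicator]; exact hwin P hP

/-- **flat uniform ⟹ T*_μ** at one prime: `RingHard8 p → RingDistHard8 p` (weight `≡ 1`). -/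
theorem ringDistHard8_of_ringHard8 (p : ℕ) [Fact p.Prime] (h : RingHard8 p) : (∃ θ : ℝ, θ < 1 ∧ ∀ c : ℕ, ∃ t₀ : ℕ, ∀ t ≥ t₀, ∃ wt : (Fin (8 * t) → Bool) → ℕ, 0 < ∑ y, wt y ∧ ∀ P : Fin (8 * t) → Smolensky.CubeFn (ZMod p) (8 * t), (∀ i, P i ∈ Smolensky.lowDeg (ZMod p) (8 * t) ((Nat.log 2 (8 * t)) ^ c)) → ((∑ y ∈ univ.filter (fun y : Fin (8 * t) → Bool => RingHLF.Rel y (fun i => decide (P i y = 1))), wt y : ℕ) : ℝ) ≤ θ * ((∑ y, wt y : ℕ) : ℝ)) := by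
  obtain ⟨θ, hθ, hc⟩ := h
  refine ⟨θ, hθ, fun c => ?_⟩
  obtain ⟨t₀, ht₀⟩ := hc c
  refine ⟨t₀, fun t ht => ⟨fun _ => 1, ?_, fun P hP => ?_⟩⟩
  · rw [Finset.sum_const, smul_eq_mul, mul_one]; exact Finset.card_pos.mpr ⟨fun _ => false, mem_univ _⟩
  · rw [sum_filter_one, sum_univ_one_patterns]
    exact ht₀ t ht P hP

/-- **T* ⟹ T*_μ** (rung currency). -/
theorem ringDistHard8Odd_of_ringCore8Odd (h : RingCore8Odd) : (∀ (p : ℕ) [Fact p.Prime], 5 ≤ p → (∃ θ : ℝ, θ < 1 ∧ ∀ c : ℕ, ∃ t₀ : ℕ, ∀ t ≥ t₀, ∃ wt : (Fin (8 * t) → Bool) → ℕ, 0 < ∑ y, wt y ∧ ∀ P : Fin (8 * t) → Smolensky.CubeFn (ZMod p) (8 * t), (∀ i, P i ∈ Smolensky.lowDeg (ZMod p) (8 * t) ((Nat.log 2 (8 * t)) ^ c)) → ((∑ y ∈ univ.filter (fun y : Fin (8 * t) → Bool => RingHLF.Rel y (fun i => decide (P i y = 1))), wt y : ℕ) : ℝ)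 ≤ θ * ((∑ y, wt y : ℕ) : ℝ))) :=
  fun p _ hp => ringDistHard8_of_ringCore8 p (h p hp)

/-- NECESSITY of T*_μ for the X-form thesis `∀ p ≥ 5, WalkHardF p` (landed chain
`walkTransportF → ringHardOfOdd → ringHard8_of_ringHard`). -/
theorem ringDistHard8Odd_of_xform (h : ∀ (p : ℕ) [Fact p.Prime], 5 ≤ p → WalkHardF p) : (∀ (p : ℕ) [Fact p.Prime], 5 ≤ p → (∃ θ : ℝ, θ < 1 ∧ ∀ c : ℕ, ∃ t₀ : ℕ, ∀ t ≥ t₀, ∃ wt : (Fin (8 * t) → Bool) → ℕ, 0 < ∑ y, wt y ∧ ∀ P : Fin (8 * t) → Smolensky.CubeFn (ZMod p) (8 * t), (∀ i, P i ∈ Smolensky.lowDeg (ZMod p) (8 * t) ((Nat.log 2 (8 * t)) ^ c)) → ((∑ y ∈ univ.filter (fun y : Fin (8 * t) → Bool => RingHLF.Rel y (fun i => decide (P i y = 1))), wt y : ℕ) : ℝ) ≤ θ * ((∑ y, wt y : ℕ) : ℝ))) :=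
  fun p _ hp => ringDistHard8_of_ringHard8 p
    (ringHard8_of_ringHard p (ringHardOfOdd p (walkTransportF p (h p hp))))

/-- **T*_μ ⟹ T**_μ at one prime, dial form**: a constant weighted loss cannot hide inside a foreign event of weight
`≥ (1-η)Σwt` once `η < 1-θ` (`η := (1-θ)/2`, `k := 1`; every family budget). -/
theorem spreadWtAt_of_ringDistHard8 (p : ℕ) [Fact p.Prime] (h : (∃ θ : ℝ, θ < 1 ∧ ∀ c : ℕ, ∃ t₀ : ℕ, ∀ t ≥ t₀, ∃ wt : (Fin (8 * t) → Bool) → ℕ, 0 < ∑ y, wt y ∧ ∀ P : Fin (8 * t) → Smolensky.CubeFn (ZMod p) (8 * t), (∀ i, P i ∈ Smolensky.lowDeg (ZMod p) (8 * t) ((Nat.log 2 (8 * t)) ^ c)) → ((∑ y ∈ univ.filter (fun y : Fin (8 * t) → Bool => RingHLF.Rel y (fun i => decide (P i y = 1))), wt y : ℕ) : ℝ) ≤ θ * ((∑ y, wt y : ℕ) : ℝ))) (k : ℕ) (hk : 1 ≤ k) :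
    ∃ η : ℝ, 0 < η ∧ ∀ c : ℕ, ∃ t₀ : ℕ, ∀ t ≥ t₀, ∃ wt : (Fin (8 * t) → Bool) → ℕ, 0 < ∑ y, wt y ∧
      (∀ P : Fin (8 * t) → Smolensky.CubeFn (ZMod p) (8 * t), (∀ i, P i ∈ Smolensky.lowDeg (ZMod p) (8 * t) ((Nat.log 2 (8 * t)) ^ c)) → ∀ m : ℕ, m ≤ (8 * t) ^ k → ∀ w : Fin m → Fin (8 * t) → Bool, ∀ Q : Fin m → Fin (8 * t) → Smolensky.CubeFn (ZMod p) (8 * t), (∀ s i, Q s i ∈ Smolensky.lowDeg (ZMod p) (8 * t) ((Nat.log 2 (8 * t)) ^ c)) → (1 - η) * ((∑ y, wt y : ℕ) : ℝ) ≤ ((∑ y ∈ univ.filter (fun y : Fin (8 * t) → Bool => ∀ s, RingHLF.Rel (w s) (fun i => decide (Q s i y = 1))), wt y : ℕ) : ℝ) → 1 / (((8 * t : ℕ) : ℝ)) ^ k * ((∑ y, wt y : ℕ) : ℝ) ≤ ((∑ y ∈ univ.filter (fun y : Fin (8 * t) → Bool => (∀ s, RingHLF.Rel (w s) (fun i =>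 decide (Q s i y = 1))) ∧ ¬ RingHLF.Rel y (fun i => decide (P i y = 1))), wt y : ℕ) : ℝ)) := by
  obtain ⟨θ, hθ, hc⟩ := h
  refine ⟨(1 - θ) / 2, by linarith, fun c => ?_⟩
  obtain ⟨t₀, ht₀⟩ := hc c
  obtain ⟨M, hM⟩ := exists_nat_gt (2 / (1 - θ))
  refine ⟨max t₀ (max M 1), fun t ht => ?_⟩
  have htt₀ : t₀ ≤ t := le_of_max_le_left ht
  have htM : (M : ℝ) ≤ t := by exact_mod_cast le_of_max_le_left (le_of_max_le_right ht)
  have ht1 : 1 ≤ t := le_of_max_le_right (le_of_max_le_right ht)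
  obtain ⟨wt, hwt, hwin⟩ := ht₀ t htt₀
  refine ⟨wt, hwt, fun P hP m hm w Q hQ hE => ?_⟩
  have h1θ : 0 < 1 - θ := by linarith
  set Wr : ℝ := ((∑ y, wt y : ℕ) : ℝ) with hWr
  have hW0 : 0 ≤ Wr := by positivity
  -- `1/(8t)^k ≤ (1-θ)/2`
  have hinv : 1 / (((8 * t : ℕ) : ℝ)) ^ k ≤ (1 - θ) / 2 := by
    have hMpos : (0 : ℝ) < M := lt_trans (by positivity) hM
    have h8t : (M : ℝ) ≤ ((8 * t : ℕ) : ℝ) := by push_cast; linarith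
    have h8tk : ((8 * t : ℕ) : ℝ) ≤ (((8 * t : ℕ) : ℝ)) ^ k := by
      have h1 : (1 : ℝ) ≤ ((8 * t : ℕ) : ℝ) := by push_cast; exact_mod_cast (by omega : 1 ≤ 8 * t)
      calc ((8 * t : ℕ) : ℝ) = (((8 * t : ℕ) : ℝ)) ^ 1 := (pow_one _).symm
        _ ≤ (((8 * t : ℕ) : ℝ)) ^ k := pow_le_pow_right₀ h1 hk
    calc 1 / (((8 * t : ℕ) : ℝ)) ^ k ≤ 1 / M := one_div_le_one_div_of_le hMpos (h8t.trans h8tk)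
      _ ≤ (1 - θ) / 2 := by
          rw [div_le_iff₀ hMpos]
          have := (div_lt_iff₀ h1θ).mp hM
          linarith
  -- the weighted win bound
  have hWin : ((∑ y ∈ univ.filter (fun y : Fin (8 * t) → Bool => RingHLF.Rel y (fun i => decide (P i y = 1))),
      wt y : ℕ) : ℝ) ≤ θ * Wr := hwin P hP
  -- split the foreign event by win / loss of the victim
  set E := univ.filter fun y : Fin (8 * t) → Bool => ∀ s, RingHLF.Rel (w s) (fun i => decide (Q s i y = 1)) with hEdef
  have hsplit := Finset.sum_filter_add_sum_filter_not E
    (fun y : Fin (8 * t) → Bool => RingHLF.Rel y (fun i => decide (P i y = 1))) (fun y => wt y)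
  have ha : ((∑ y ∈ E.filter (fun y : Fin (8 * t) → Bool => RingHLF.Rel y (fun i => decide (P i y = 1))), wt y : ℕ) : ℝ)
      ≤ θ * Wr := by
    refine le_trans ?_ hWin
    exact_mod_cast Finset.sum_le_sum_of_subset (fun y hy => by
      simp only [mem_filter, mem_univ, true_and] at hy ⊢; exact hy.2)
  have hl : (E.filter fun y : Fin (8 * t) → Bool => ¬ RingHLF.Rel y (fun i => decide (P i y = 1)))
      = (univ.filter fun y : Fin (8 * t) → Bool =>
          (∀ s, RingHLF.Rel (w s) (fun i => decide (Q s i y = 1))) ∧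
            ¬ RingHLF.Rel y (fun i => decide (P i y = 1))) := by
    rw [hEdef, Finset.filter_filter]
  have hsum : ((∑ y ∈ E.filter (fun y : Fin (8 * t) → Bool => RingHLF.Rel y (fun i => decide (P i y = 1))), wt y : ℕ) : ℝ)
      + ((∑ y ∈ E.filter (fun y : Fin (8 * t) → Bool => ¬ RingHLF.Rel y (fun i => decide (P i y = 1))), wt y : ℕ) : ℝ)
        = ((∑ y ∈ E, wt y : ℕ) : ℝ) := by exact_mod_cast hsplit
  rw [← hl]
  have := mul_le_mul_of_nonneg_right hinv hW0
  have hE' : (1 - (1 - θ) / 2) * Wr ≤ ((∑ y ∈ E, wt y : ℕ) : ℝ) := hE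
  nlinarith

/-- **T*_μ ⟹ T**_μ** (rung currency): `RingDistHard8Odd → SpreadDistOdd`. -/
theorem spreadDistOdd_of_ringDistHard8Odd (h : (∀ (p : ℕ) [Fact p.Prime], 5 ≤ p → (∃ θ : ℝ, θ < 1 ∧ ∀ c : ℕ, ∃ t₀ : ℕ, ∀ t ≥ t₀, ∃ wt : (Fin (8 * t) → Bool) → ℕ, 0 < ∑ y, wt y ∧ ∀ P : Fin (8 * t) → Smolensky.CubeFn (ZMod p) (8 * t), (∀ i, P i ∈ Smolensky.lowDeg (ZMod p) (8 * t) ((Nat.log 2 (8 * t)) ^ c)) → ((∑ y ∈ univ.filter (fun y : Fin (8 * t) → Bool => RingHLF.Rel y (fun i => decide (P i y = 1))), wt y : ℕ) : ℝ) ≤ θ * ((∑ y, wt y : ℕ) : ℝ)))) : (∀ (p : ℕ) [Fact p.Prime], 5 ≤ p → ∃ η : ℝ, 0 < η ∧ ∀ c : ℕ, ∃ k t₀ : ℕ, ∀ t ≥ t₀, ∃ wt : (Fin (8 * t) → Bool) → ℕ, 0 < ∑ y, wt y ∧ ∀ P : Fin (8 * t) → Literature.Computability.MetaComplexity.Smolensky.CubeFn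 (ZMod p) (8 * t), (∀ i, P i ∈ Literature.Computability.MetaComplexity.Smolensky.lowDeg (ZMod p) (8 * t) ((Nat.log 2 (8 * t)) ^ c)) → ∀ m : ℕ, m ≤ (8 * t) ^ k → ∀ w : Fin m → Fin (8 * t) → Bool, ∀ Q : Fin m → Fin (8 * t) → Literature.Computability.MetaComplexity.Smolensky.CubeFn (ZMod p) (8 * t), (∀ s i, Q s i ∈ Literature.Computability.MetaComplexity.Smolensky.lowDeg (ZMod p) (8 * t) ((Nat.log 2 (8 * t)) ^ c)) → (1 - η) * ((∑ y, wt y : ℕ) : ℝ) ≤ ((∑ y ∈ Finset.univ.filter (fun y : Fin (8 * t) → Bool => ∀ s, Literature.Computability.QuantumComplexity.RingHLF.Rel (w s) (fun i => decide (Q s i y = 1))), wt y : ℕ) : ℝ) → 1 / (((8 * t : ℕ) : ℝ)) ^ k * ((∑ y, wt y : ℕ) : ℝ) ≤ ((∑ y ∈ Finset.univ.filter (fun y : Fin (8 * t) → Bool => (∀ s, Literature.Computability.QuantumComplexity.RingHLF.Rel (w s) (fun i => decide (Q s i y = 1))) ∧ ¬ Literature.Computability.QuantumComplexity.RingHLF.Rel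 y (fun i => decide (P i y = 1))), wt y : ℕ) : ℝ)) := by
  intro p _ hp
  obtain ⟨η, hη, hc⟩ := spreadWtAt_of_ringDistHard8 p (h p hp) 1 le_rfl
  exact ⟨η, hη, fun c => ⟨1, hc c⟩⟩

/-- NECESSITY of T**_μ: `T* → SpreadDistOdd` and from the X-form. -/
theorem spreadDistOdd_of_ringCore8Odd (h : RingCore8Odd) : (∀ (p : ℕ) [Fact p.Prime], 5 ≤ p → ∃ η : ℝ, 0 < η ∧ ∀ c : ℕ, ∃ k t₀ : ℕ, ∀ t ≥ t₀, ∃ wt : (Fin (8 * t) → Bool) → ℕ, 0 < ∑ y, wt y ∧ ∀ P : Fin (8 * t) → Literature.Computability.MetaComplexity.Smolensky.CubeFn (ZMod p) (8 * t), (∀ i, P i ∈ Literature.Computability.MetaComplexity.Smolensky.lowDeg (ZMod p) (8 * t) ((Nat.log 2 (8 * t)) ^ c)) → ∀ m : ℕ, m ≤ (8 * t) ^ k → ∀ w : Fin m → Fin (8 * t) → Bool, ∀ Q : Fin m → Fin (8 * t) → Literature.Computability.MetaComplexity.Smolensky.CubeFn (ZMod p) (8 * t), (∀ s i, Q s i ∈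 Literature.Computability.MetaComplexity.Smolensky.lowDeg (ZMod p) (8 * t) ((Nat.log 2 (8 * t)) ^ c)) → (1 - η) * ((∑ y, wt y : ℕ) : ℝ) ≤ ((∑ y ∈ Finset.univ.filter (fun y : Fin (8 * t) → Bool => ∀ s, Literature.Computability.QuantumComplexity.RingHLF.Rel (w s) (fun i => decide (Q s i y = 1))), wt y : ℕ) : ℝ) → 1 / (((8 * t : ℕ) : ℝ)) ^ k * ((∑ y, wt y : ℕ) : ℝ) ≤ ((∑ y ∈ Finset.univ.filter (fun y : Fin (8 * t) → Bool => (∀ s, Literature.Computability.QuantumComplexity.RingHLF.Rel (w s) (fun i => decide (Q s i y = 1))) ∧ ¬ Literature.Computability.QuantumComplexity.RingHLF.Rel y (fun i => decide (P i y = 1))), wt y : ℕ) : ℝ)) :=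
  spreadDistOdd_of_ringDistHard8Odd (ringDistHard8Odd_of_ringCore8Odd h)

/-- SpreadCore bridge helper `spreadDistOdd_of_xform` (lens-6 g6 SpreadCoreBridge v2; see the enclosing section docstring). -/
theorem spreadDistOdd_of_xform (h : ∀ (p : ℕ) [Fact p.Prime], 5 ≤ p → WalkHardF p) : (∀ (p : ℕ) [Fact p.Prime], 5 ≤ p → ∃ η : ℝ, 0 < η ∧ ∀ c : ℕ, ∃ k t₀ : ℕ, ∀ t ≥ t₀, ∃ wt : (Fin (8 * t) → Bool) → ℕ, 0 < ∑ y, wt y ∧ ∀ P : Fin (8 * t) → Literature.Computability.MetaComplexity.Smolensky.CubeFn (ZMod p) (8 * t), (∀ i, P i ∈ Literature.Computability.MetaComplexity.Smolensky.lowDeg (ZMod p) (8 * t) ((Nat.log 2 (8 * t)) ^ c)) → ∀ m : ℕ, m ≤ (8 * t) ^ k → ∀ w : Fin m → Fin (8 * t) → Bool, ∀ Q : Fin m → Fin (8 * t) → Literature.Computability.MetaComplexity.Smolensky.CubeFn (ZMod p) (8 * t), (∀ s i, Q s i ∈ Literature.Computability.MetaComplexity.Smolensky.lowDeg (ZMod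 p) (8 * t) ((Nat.log 2 (8 * t)) ^ c)) → (1 - η) * ((∑ y, wt y : ℕ) : ℝ) ≤ ((∑ y ∈ Finset.univ.filter (fun y : Fin (8 * t) → Bool => ∀ s, Literature.Computability.QuantumComplexity.RingHLF.Rel (w s) (fun i => decide (Q s i y = 1))), wt y : ℕ) : ℝ) → 1 / (((8 * t : ℕ) : ℝ)) ^ k * ((∑ y, wt y : ℕ) : ℝ) ≤ ((∑ y ∈ Finset.univ.filter (fun y : Fin (8 * t) → Bool => (∀ s, Literature.Computability.QuantumComplexity.RingHLF.Rel (w s) (fun i => decide (Q s i y = 1))) ∧ ¬ Literature.Computability.QuantumComplexity.RingHLF.Rel y (fun i => decide (P i y = 1))), wt y : ℕ) : ℝ)) :=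
  spreadDistOdd_of_ringDistHard8Odd (ringDistHard8Odd_of_xform h)

/-- NECESSITY of the residual (vacuous form): `T* → CoverLiftDistOdd`. -/
theorem coverLiftDistOdd_of_ringCore8Odd (h : RingCore8Odd) : (RingPolyLoss8Odd → (∀ (p : ℕ) [Fact p.Prime], 5 ≤ p → ∃ η : ℝ, 0 < η ∧ ∀ c : ℕ, ∃ k t₀ : ℕ, ∀ t ≥ t₀, ∃ wt : (Fin (8 * t) → Bool) → ℕ, 0 < ∑ y, wt y ∧ ∀ P : Fin (8 * t) → Literature.Computability.MetaComplexity.Smolensky.CubeFn (ZMod p) (8 * t), (∀ i, P i ∈ Literature.Computability.MetaComplexity.Smolensky.lowDeg (ZMod p) (8 * t) ((Nat.log 2 (8 * t)) ^ c)) → ∀ m : ℕ, m ≤ (8 * t) ^ k → ∀ w : Fin m → Fin (8 * t) → Bool, ∀ Q : Fin m → Fin (8 * t) → Literature.Computability.MetaComplexity.Smolensky.CubeFn (ZMod p) (8 * t), (∀ s i, Q s i ∈ Literature.Computability.MetaComplexity.Smolensky.lowDeg (ZMod p) (8 * t) ((Nat.log 2 (8 * t)) ^ c)) → (1 - η) *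 ((∑ y, wt y : ℕ) : ℝ) ≤ ((∑ y ∈ Finset.univ.filter (fun y : Fin (8 * t) → Bool => ∀ s, Literature.Computability.QuantumComplexity.RingHLF.Rel (w s) (fun i => decide (Q s i y = 1))), wt y : ℕ) : ℝ) → 1 / (((8 * t : ℕ) : ℝ)) ^ k * ((∑ y, wt y : ℕ) : ℝ) ≤ ((∑ y ∈ Finset.univ.filter (fun y : Fin (8 * t) → Bool => (∀ s, Literature.Computability.QuantumComplexity.RingHLF.Rel (w s) (fun i => decide (Q s i y = 1))) ∧ ¬ Literature.Computability.QuantumComplexity.RingHLF.Rel y (fun i => decide (P i y = 1))), wt y : ℕ) : ℝ))) :=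
  fun _ => spreadDistOdd_of_ringCore8Odd h

/-- **flat ⟹ weighted**: `SpreadLoss8Odd → SpreadDistOdd` (weight `≡ 1`). -/
theorem spreadDistOdd_of_spreadLoss8Odd (h : (∀ (p : ℕ) [Fact p.Prime], 5 ≤ p → ∃ η : ℝ, 0 < η ∧ ∃ k : ℕ, ∀ c : ℕ, ∃ t₀ : ℕ, ∀ t ≥ t₀, ∀ P : Fin (8 * t) → Literature.Computability.MetaComplexity.Smolensky.CubeFn (ZMod p) (8 * t), (∀ i, P i ∈ Literature.Computability.MetaComplexity.Smolensky.lowDeg (ZMod p) (8 * t) ((Nat.log 2 (8 * t)) ^ c)) → ∀ m : ℕ, m ≤ (8 * t) ^ k → ∀ w : Fin m → Fin (8 * t) → Bool, ∀ Q : Fin m → Fin (8 * t) → Literature.Computability.MetaComplexity.Smolensky.CubeFn (ZMod p) (8 * t), (∀ s i, Q s i ∈ Literature.Computability.MetaComplexity.Smolensky.lowDeg (ZMod p) (8 * t) ((Nat.log 2 (8 * t)) ^ c)) → (1 - η) * (2 : ℝ) ^ (8 * t) ≤ ((Finset.univ.filter fun y : Fin (8 * t) → Bool => ∀ s, Literature.Computability.QuantumComplexity.RingHLF.Rel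 (w s) (fun i => decide (Q s i y = 1))).card : ℝ) → 1 / (((8 * t : ℕ) : ℝ)) ^ k * (2 : ℝ) ^ (8 * t) ≤ ((Finset.univ.filter fun y : Fin (8 * t) → Bool => (∀ s, Literature.Computability.QuantumComplexity.RingHLF.Rel (w s) (fun i => decide (Q s i y = 1))) ∧ ¬ Literature.Computability.QuantumComplexity.RingHLF.Rel y (fun i => decide (P i y = 1))).card : ℝ))) : (∀ (p : ℕ) [Fact p.Prime], 5 ≤ p → ∃ η : ℝ, 0 < η ∧ ∀ c : ℕ, ∃ k t₀ : ℕ, ∀ t ≥ t₀, ∃ wt : (Fin (8 * t) → Bool) → ℕ, 0 < ∑ y, wt y ∧ ∀ P : Fin (8 * t) → Literature.Computability.MetaComplexity.Smolensky.CubeFn (ZMod p) (8 * t), (∀ i, P i ∈ Literature.Computability.MetaComplexity.Smolensky.lowDeg (ZMod p) (8 * t) ((Nat.log 2 (8 * t)) ^ c)) → ∀ m : ℕ, m ≤ (8 * t) ^ k → ∀ w : Fin m → Fin (8 * t) → Bool, ∀ Q : Fin m → Fin (8 * t) → Literature.Computability.MetaComplexity.Smolensky.CubeFn (ZMod p) (8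 * t), (∀ s i, Q s i ∈ Literature.Computability.MetaComplexity.Smolensky.lowDeg (ZMod p) (8 * t) ((Nat.log 2 (8 * t)) ^ c)) → (1 - η) * ((∑ y, wt y : ℕ) : ℝ) ≤ ((∑ y ∈ Finset.univ.filter (fun y : Fin (8 * t) → Bool => ∀ s, Literature.Computability.QuantumComplexity.RingHLF.Rel (w s) (fun i => decide (Q s i y = 1))), wt y : ℕ) : ℝ) → 1 / (((8 * t : ℕ) : ℝ)) ^ k * ((∑ y, wt y : ℕ) : ℝ) ≤ ((∑ y ∈ Finset.univ.filter (fun y : Fin (8 * t) → Bool => (∀ s, Literature.Computability.QuantumComplexity.RingHLF.Rel (w s) (fun i => decide (Q s i y = 1))) ∧ ¬ Literature.Computability.QuantumComplexity.RingHLF.Rel y (fun i => decide (P i y = 1))), wt y : ℕ) : ℝ)) := by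
  intro p _ hp
  obtain ⟨η, hη, k, hk⟩ := h p hp
  refine ⟨η, hη, fun c => ?_⟩
  obtain ⟨t₀, ht₀⟩ := hk c
  refine ⟨k, t₀, fun t ht => ⟨fun _ => 1, ?_, fun P hP m hm w Q hQ hE => ?_⟩⟩
  · rw [Finset.sum_const, smul_eq_mul, mul_one]; exact Finset.card_pos.mpr ⟨fun _ => false, mem_univ _⟩
  · beta_reduce at hE ⊢
    rw [sum_filter_one, sum_univ_one_patterns] at hE ⊢
    exact ht₀ t ht P hP m hm w Q hQ hE

/-- **flat residual ⟹ weighted residual**: `CoverLift8Odd → CoverLiftDistOdd`. -/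
theorem coverLiftDistOdd_of_coverLift8Odd (h : (RingPolyLoss8Odd → (∀ (p : ℕ) [Fact p.Prime], 5 ≤ p → ∃ η : ℝ, 0 < η ∧ ∃ k : ℕ, ∀ c : ℕ, ∃ t₀ : ℕ, ∀ t ≥ t₀, ∀ P : Fin (8 * t) → Literature.Computability.MetaComplexity.Smolensky.CubeFn (ZMod p) (8 * t), (∀ i, P i ∈ Literature.Computability.MetaComplexity.Smolensky.lowDeg (ZMod p) (8 * t) ((Nat.log 2 (8 * t)) ^ c)) → ∀ m : ℕ, m ≤ (8 * t) ^ k → ∀ w : Fin m → Fin (8 * t) → Bool, ∀ Q : Fin m → Fin (8 * t) → Literature.Computability.MetaComplexity.Smolensky.CubeFn (ZMod p) (8 * t), (∀ s i, Q s i ∈ Literature.Computability.MetaComplexity.Smolensky.lowDeg (ZMod p) (8 * t) ((Nat.log 2 (8 * t)) ^ c)) → (1 - η) * (2 : ℝ) ^ (8 * t) ≤ ((Finset.univ.filter fun y : Fin (8 * t) → Bool => ∀ s, Literature.Computability.QuantumComplexity.RingHLF.Rel (w s) (fun i => decide (Q s i y = 1))).card : ℝ) → 1 / (((8 * t : ℕ)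 : ℝ)) ^ k * (2 : ℝ) ^ (8 * t) ≤ ((Finset.univ.filter fun y : Fin (8 * t) → Bool => (∀ s, Literature.Computability.QuantumComplexity.RingHLF.Rel (w s) (fun i => decide (Q s i y = 1))) ∧ ¬ Literature.Computability.QuantumComplexity.RingHLF.Rel y (fun i => decide (P i y = 1))).card : ℝ)))) : (RingPolyLoss8Odd → (∀ (p : ℕ) [Fact p.Prime], 5 ≤ p → ∃ η : ℝ, 0 < η ∧ ∀ c : ℕ, ∃ k t₀ : ℕ, ∀ t ≥ t₀, ∃ wt : (Fin (8 * t) → Bool) → ℕ, 0 < ∑ y, wt y ∧ ∀ P : Fin (8 * t) → Literature.Computability.MetaComplexity.Smolensky.CubeFn (ZMod p) (8 * t), (∀ i, P i ∈ Literature.Computability.MetaComplexity.Smolensky.lowDeg (ZMod p) (8 * t) ((Nat.log 2 (8 * t)) ^ c)) → ∀ m : ℕ, m ≤ (8 * t) ^ k → ∀ w : Fin m → Fin (8 * t) → Bool, ∀ Q : Fin m → Fin (8 * t) → Literature.Computability.MetaComplexity.Smolensky.CubeFn (ZMod p) (8 * t), (∀ s i, Q s i ∈ Literature.Computability.MetaComplexity.Smolensky.lowDeg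 (ZMod p) (8 * t) ((Nat.log 2 (8 * t)) ^ c)) → (1 - η) * ((∑ y, wt y : ℕ) : ℝ) ≤ ((∑ y ∈ Finset.univ.filter (fun y : Fin (8 * t) → Bool => ∀ s, Literature.Computability.QuantumComplexity.RingHLF.Rel (w s) (fun i => decide (Q s i y = 1))), wt y : ℕ) : ℝ) → 1 / (((8 * t : ℕ) : ℝ)) ^ k * ((∑ y, wt y : ℕ) : ℝ) ≤ ((∑ y ∈ Finset.univ.filter (fun y : Fin (8 * t) → Bool => (∀ s, Literature.Computability.QuantumComplexity.RingHLF.Rel (w s) (fun i => decide (Q s i y = 1))) ∧ ¬ Literature.Computability.QuantumComplexity.RingHLF.Rel y (fun i => decide (P i y = 1))), wt y : ℕ) : ℝ))) :=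
  fun hP => spreadDistOdd_of_spreadLoss8Odd (h hP)

/-- **flat ⟹ weighted, many rings**: `MultiRingHard8Odd → MultiRingDistOdd` (weight `≡ 1`). -/
theorem multiRingDistOdd_of_multiRingHard8Odd (h : (∀ (p : ℕ) [Fact p.Prime], 5 ≤ p → ∃ θ : ℝ, θ < 1 ∧ ∀ c : ℕ, ∃ K t₀ : ℕ, ∀ t ≥ t₀, ∀ P : Fin ((8 * t) ^ K) → Fin (8 * t) → Literature.Computability.MetaComplexity.Smolensky.CubeFn (ZMod p) ((8 * t) ^ K * (8 * t)), (∀ j i, P j i ∈ Literature.Computability.MetaComplexity.Smolensky.lowDeg (ZMod p) ((8 * t) ^ K * (8 * t)) ((Nat.log 2 (8 * t)) ^ c)) → ((Finset.univ.filter fun X : Fin ((8 * t) ^ K) → Fin (8 * t) → Bool => ∀ j, Literature.Computability.QuantumComplexity.RingHLF.Rel (X j) (fun i => decide (P j i (fun kk => X (finProdFinEquiv.symm kk).1 (finProdFinEquiv.symm kk).2) = 1))).card : ℝ) ≤ θ * (2 : ℝ) ^ ((8 * t) ^ K * (8 * t)))) : (∀ (p : ℕ) [Fact p.Prime], 5 ≤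 p → ∃ θ : ℝ, θ < 1 ∧ ∀ c : ℕ, ∃ K t₀ : ℕ, ∀ t ≥ t₀, ∃ wt : (Fin (8 * t) → Bool) → ℕ, 0 < ∑ y, wt y ∧ ∀ P : Fin ((8 * t) ^ K) → Fin (8 * t) → Literature.Computability.MetaComplexity.Smolensky.CubeFn (ZMod p) ((8 * t) ^ K * (8 * t)), (∀ j i, P j i ∈ Literature.Computability.MetaComplexity.Smolensky.lowDeg (ZMod p) ((8 * t) ^ K * (8 * t)) ((Nat.log 2 (8 * t)) ^ c)) → (∑ X ∈ Finset.univ.filter (fun X : Fin ((8 * t) ^ K) → Fin (8 * t) → Bool => ∀ j, Literature.Computability.QuantumComplexity.RingHLF.Rel (X j) (fun i => decide (P j i (fun kk => X (finProdFinEquiv.symm kk).1 (finProdFinEquiv.symm kk).2) = 1))), ∏ j, ((wt (X j) : ℕ) : ℝ)) ≤ θ * ((∑ y, wt y : ℕ) : ℝ) ^ ((8 * t) ^ K)) := by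
  intro p _ hp
  obtain ⟨θ, hθ, hc⟩ := h p hp
  refine ⟨θ, hθ, fun c => ?_⟩
  obtain ⟨K, t₀, ht₀⟩ := hc c
  refine ⟨K, t₀, fun t ht => ⟨fun _ => 1, ?_, fun P hP => ?_⟩⟩
  · rw [Finset.sum_const, smul_eq_mul, mul_one]; exact Finset.card_pos.mpr ⟨fun _ => false, mem_univ _⟩
  · have h1 := ht₀ t ht P hP
    beta_reduce
    rw [sum_univ_one_patterns, ← pow_mul, mul_comm (8 * t)]
    simpa only [Nat.cast_one, Finset.prod_const_one, Finset.sum_const, nsmul_eq_mul, mul_one] using h1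



end Summit.QuantumAdvantage.QuantumAdvantage.Theorems.SpreadCore
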